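import Summits.ValiantsHypothesis.ValiantsHypothesis.Theses.AnyonJets
import Summits.ValiantsHypothesis.ValiantsHypothesis.Theorems.AnyonJetsTwoAdicShadow
import Summits.ValiantsHypothesis.ValiantsHypothesis.Theorems.AnyonJetsConstantFreeJetGrowthDefs
import Literature.Computability.AlgebraicComplexity.PermanentBitsPPoly
import Literature.Computability.AlgebraicComplexity.SkewCircuitFormalDegree
import Literature.Computability.AlgebraicComplexity.FermionicPencil
import Literature.Computability.AlgebraicComplexity.ConstantFreeNumerals
import Mathlib.NumberTheory.Padics.PadicVal.Basic
import Mathlib.Data.Nat.Factorization.Basic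

/-!
# AnyonJets — crux `JetConstantElim` (stmt-ValiantsHypothesis-16737), line `birth`, multiplier
# BYPASS, Boolean half: the Boolean far side gives MULTIPLIER-ROBUST constant-free jet growth

Companion of `AnyonJetsJetConstantElimMultiplierBypass.lean`. There the route's assembly was
re-glued as `closes_ultimate : CF^ult → CE^ult → U → VH`, with `CE^ult` (constant elimination up to
an integer multiplier of polynomial bit-length) obtainable from the line's stubs WITHOUT
`stub_multiplierRemoval`. This file supplies the evidence chain for the other hypothesis:

* `cfUltimate_of_perModPowBooleanHard : PerModPowBooleanHard → CF^ult`, where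
  `CF^ult := ∀ c ∃ k ≥ 1 ∀ n₀ ∃ n ≥ n₀ ∀ M ≥ 1, v₂(M) ≤ n^c → n^c ≤ τ(M·J_(n,k))`
  (statement inline; `J_(n,k)` = the tree's `jet n k`).

This is the route's PROVED support `BooleanShadowToCF` (`PerModPowBooleanHard → CF`,
`booleanShadowToCF_proof`) with an integer multiplier carried along, and the point of the bypass:
**a multiplier dissolves in the Boolean shadow.** If for some `c` every fixed jet `J_(n,j)` had a
multiple `M_j·J_(n,j)` (`v₂(M_j) ≤ n^c`) of constant-free cost `< n^c` eventually, write
`M_j = 2^{e_j} m_j` (`m_j` odd, `e_j ≤ E := n^c`) and work modulo `2^K`, `K = k + E`: `m_j` is a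
unit there (`u_j = m_j⁻¹ mod 2^K`, an integer `< 2^K`, `τ(u_j) = O(K)`), so the integer polynomial
`T = Σ_{j<k} (−2)^j 2^{E−e_j} u_j · (M_j J_(n,j))` has `τ(T) = k·O(K) + Σ_j τ(M_j J_(n,j))` and takes,
at every `0/1` point `y`, the value `T(y) ≡ 2^E Σ_{j<k} (−2)^j J_(n,j)(y) ≡ 2^E per(y) (mod 2^K)` (the
proved `TwoAdicShadow`: `per − Σ_{j<k}(−2)^j J_j ∈ 2^k ℤ[x]`). Bürgisser's Boolean simulation of `T`
modulo `2^K` (`cktSize_testBits_aeval_eval`) then outputs the `K` bits of `2^E·(per(y) mod 2^k)`;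
bits `E, …, E+k−1` (a free re-wiring, `CktSize.outMap`) are the `k` low bits of the `0/1`
permanent — by `B₂`-circuits of size `≤ n^{11c+11}` for all large `n` and every `k`, contradicting
`PerModPowBooleanHard`. The `2`-part of the multiplier only SHIFTS bits; the odd part is inverted.

Consequently the re-glued route `closes_ultimate (CF^ult) (CE^ult) (U)` has the same Boolean
evidence as the filed one and does not need `stub_multiplierRemoval`: the crux's open content is
`stub_integralMultiple` (+ `log₂ M ≤ poly`). Honest framing: `PerModPowBooleanHard` (⊕W[1]-type
Boolean hardness of per mod `2^k`, nonuniform) stays OPEN; VP ≠ VNP is NOT proved here.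

References: L. G. Valiant, *The complexity of computing the permanent*, TCS 8 (1979), §4;
P. Bürgisser, *Cook's versus Valiant's hypothesis*, TCS 235 (2000), §5 (A3) (Boolean simulation);
R. Curticapean, M. Xia, *Parameterizing the permanent*, FOCS 2015 (per mod `2^k`);
P. Bürgisser, *On defining integers …*, Comput. Complexity 18 (2009), §1 ("ultimately").
-/

noncomputable section

-- single-conjunct layout: Sub = Summit, duplicated namespace component intended
set_option linter.dupNamespace false

namespace Summit.ValiantsHypothesis.ValiantsHypothesis.Theorems.AnyonJets.JetConstantElim

open Literature.Computability.AlgebraicComplexity Literature.Computability.Complexity MvPolynomial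
  ArithCircuit Finset
open Summit.ValiantsHypothesis.ValiantsHypothesis.Theses.AnyonJets
open Summit.ValiantsHypothesis.ValiantsHypothesis.Theorems.AnyonJets.ConstantFreeJetGrowth (jet)

/-! ### Arithmetic of the multiplier modulo `2^K` -/

/-- The odd part of a multiplier is invertible modulo `2^K`: for `m` odd,
`(m : ZMod (2^K)) · ((m : ZMod (2^K))⁻¹.val : ℕ) = 1`. [folklore] -/
theorem odd_mul_invVal_eq_one (K m : ℕ) (hm : Odd m) :
    ((m : ZMod (2 ^ K)) * ((((m : ZMod (2 ^ K)))⁻¹).val : ℕ) : ZMod (2 ^ K)) = 1 := by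
  haveI : NeZero (2 ^ K) := ⟨pow_ne_zero _ two_ne_zero⟩
  rw [ZMod.natCast_zmod_val]
  refine ZMod.coe_mul_inv_eq_one m ?_
  have h2 : Nat.Coprime 2 m := (Nat.Prime.coprime_iff_not_dvd Nat.prime_two).2 hm.not_two_dvd_nat
  exact (Nat.Coprime.pow_right K h2.symm)

/-- The scalar of the `j`-th term times its multiplier: with `M = 2^e m`, `m` odd, `e ≤ E`,
`u = m⁻¹ mod 2^K`: `((−2)^j 2^{E−e} u) · M = (−2)^j 2^E` in `ZMod (2^K)`. [folklore] -/
theorem termScalar_mul_multiplier (K E e m j : ℕ) (hm : Odd m) (he : e ≤ E) :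
    (((-2 : ℤ) ^ j * 2 ^ (E - e) * ((((m : ZMod (2 ^ K)))⁻¹).val : ℕ) : ℤ) : ZMod (2 ^ K)) *
        ((2 ^ e * m : ℕ) : ZMod (2 ^ K)) =
      ((-2 : ZMod (2 ^ K)) ^ j * 2 ^ E) := by
  have hu := odd_mul_invVal_eq_one K m hm
  push_cast
  have hE : (2 : ZMod (2 ^ K)) ^ E = 2 ^ (E - e) * 2 ^ e := by
    rw [← pow_add, Nat.sub_add_cancel he]
  rw [hE]
  calc (-2 : ZMod (2 ^ K)) ^ j * 2 ^ (E - e) * ((((m : ZMod (2 ^ K)))⁻¹).val : ZMod (2 ^ K)) *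
        (2 ^ e * (m : ZMod (2 ^ K)))
      = (-2 : ZMod (2 ^ K)) ^ j * (2 ^ (E - e) * 2 ^ e) *
          ((m : ZMod (2 ^ K)) * ((((m : ZMod (2 ^ K)))⁻¹).val : ZMod (2 ^ K))) := by ring
    _ = (-2 : ZMod (2 ^ K)) ^ j * (2 ^ (E - e) * 2 ^ e) := by rw [hu, mul_one]

/-- Bit extraction after a shift: for `i < k`, bit `E + i` of `(2^E N) mod 2^{k+E}` is bit `i` of
`N`. [folklore] -/
theorem testBit_two_pow_mul_mod (E k N i : ℕ) (hi : i < k) :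
    Nat.testBit (2 ^ E * N % 2 ^ (k + E)) (E + i) = Nat.testBit N i := by
  rw [Nat.testBit_mod_two_pow, Nat.testBit_two_pow_mul]
  simp [show E + i < k + E by omega]

/-! ### Size bookkeeping -/

/-- The exponent bookkeeping of the simulation: for `n ≥ 64`, `k ≤ n` and
`A ≤ k(9(k + n^c) + 2) + 4(n+1)^4 + k n^c + k`, `(A+1)(2 + 65 (k + n^c + 2)^3) ≤ n^{11c+11}`.
[folklore] -/
theorem size_le_pow_ultimate {n k c A : ℕ} (hn : 64 ≤ n) (hk : k ≤ n)
    (hA : A ≤ k * (9 * (k + n ^ c) + 2) + 4 * (n + 1) ^ 4 + k * n ^ c + k) :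
    (A + 1) * (2 + 65 * (k + n ^ c + 2) ^ 3) ≤ n ^ (11 * c + 11) := by
  set Y := n ^ (c + 1) with hY
  have hn1 : 1 ≤ n := by omega
  have hnY : n ≤ Y := by
    calc n = n ^ 1 := (pow_one n).symm
      _ ≤ n ^ (c + 1) := Nat.pow_le_pow_right hn1 (by omega)
  have hBY : n ^ c ≤ Y := Nat.pow_le_pow_right hn1 (by omega)
  have hY64 : 64 ≤ Y := hn.trans hnY
  have hkY : k ≤ Y := hk.trans hnY
  -- the gate cost
  have hK : k + n ^ c + 2 ≤ 3 * Y := by omega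
  have hg : 2 + 65 * (k + n ^ c + 2) ^ 3 ≤ Y ^ 5 := by
    have h1 : (k + n ^ c + 2) ^ 3 ≤ (3 * Y) ^ 3 := Nat.pow_le_pow_left hK 3
    have h2 : 1757 ≤ Y ^ 2 := by nlinarith
    calc 2 + 65 * (k + n ^ c + 2) ^ 3 ≤ 2 + 65 * (3 * Y) ^ 3 := by omega
      _ ≤ 1757 * Y ^ 3 := by
          have : 1 ≤ Y ^ 3 := Nat.one_le_pow _ _ (by omega)
          nlinarith
      _ ≤ Y ^ 2 * Y ^ 3 := Nat.mul_le_mul_right _ h2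
      _ = Y ^ 5 := by rw [← pow_add]
  -- the circuit size
  have h4 : 4 * (n + 1) ^ 4 ≤ n ^ 5 := by
    have : (n + 1) ^ 4 ≤ (2 * n) ^ 4 := Nat.pow_le_pow_left (by omega) 4
    calc 4 * (n + 1) ^ 4 ≤ 4 * (2 * n) ^ 4 := by omega
      _ = 64 * n ^ 4 := by ring
      _ ≤ n * n ^ 4 := Nat.mul_le_mul_right _ hn
      _ = n ^ 5 := by ring
  have hn5 : n ^ 5 ≤ Y ^ 5 := Nat.pow_le_pow_left hnY 5
  have hA1 : A + 1 ≤ Y ^ 6 := by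
    have h1 : k * (9 * (k + n ^ c) + 2) ≤ Y * (18 * Y + 2) := Nat.mul_le_mul hkY (by omega)
    have h2 : k * n ^ c ≤ Y * Y := Nat.mul_le_mul hkY hBY
    have h3 : A + 1 ≤ Y ^ 5 + 23 * Y ^ 2 := by nlinarith
    have h5 : 23 * Y ^ 2 ≤ Y ^ 3 := by
      calc 23 * Y ^ 2 ≤ Y * Y ^ 2 := Nat.mul_le_mul_right _ (by omega)
        _ = Y ^ 3 := by ring
    have h6 : Y ^ 3 ≤ Y ^ 5 := Nat.pow_le_pow_right (by omega) (by omega)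
    have h7 : Y ^ 5 + Y ^ 5 ≤ Y ^ 6 := by
      calc Y ^ 5 + Y ^ 5 = 2 * Y ^ 5 := by ring
        _ ≤ Y * Y ^ 5 := Nat.mul_le_mul_right _ (by omega)
        _ = Y ^ 6 := by ring
    omega
  calc (A + 1) * (2 + 65 * (k + n ^ c + 2) ^ 3) ≤ Y ^ 6 * Y ^ 5 := Nat.mul_le_mul hA1 hg
    _ = Y ^ 11 := by rw [← pow_add]
    _ = n ^ (11 * c + 11) := by rw [hY, ← pow_mul]; ring_nf

/-- `τ` of the `j`-th scalar `(−2)^j 2^{E−e} u`, `u < 2^K`, `j, E ≤ K`: at most `9K + 1`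
(`τ(C a) ≤ 3 log₂ |a| + 1`, `|a| < 2^{3K}`). [folklore] -/
theorem constantFreeComplexity_termScalar_le {σ : Type*} (K E e j u : ℕ) (hj : j ≤ K) (hE : E ≤ K)
    (hu : u < 2 ^ K) :
    constantFreeComplexity (C ((-2 : ℤ) ^ j * 2 ^ (E - e) * (u : ℤ)) : MvPolynomial σ ℤ) ≤
      9 * K + 1 := by
  refine (constantFreeComplexity_C_intCast_le_log _).trans ?_
  have habs : ((-2 : ℤ) ^ j * 2 ^ (E - e) * (u : ℤ)).natAbs = 2 ^ j * 2 ^ (E - e) * u := by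
    rw [Int.natAbs_mul, Int.natAbs_mul, Int.natAbs_pow, Int.natAbs_pow]
    simp
  rw [habs]
  have hle : Nat.log 2 (2 ^ j * 2 ^ (E - e) * u) ≤ 3 * K := by
    rcases Nat.eq_zero_or_pos (2 ^ j * 2 ^ (E - e) * u) with h0 | hpos
    · rw [h0, Nat.log_zero_right]; exact Nat.zero_le _
    · have hlt : 2 ^ j * 2 ^ (E - e) * u < 2 ^ (3 * K) := by
        calc 2 ^ j * 2 ^ (E - e) * u < 2 ^ j * 2 ^ (E - e) * 2 ^ K :=
              Nat.mul_lt_mul_of_pos_left hu (by positivity)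
          _ = 2 ^ (j + (E - e) + K) := by rw [pow_add, pow_add]
          _ ≤ 2 ^ (3 * K) := Nat.pow_le_pow_right (by norm_num) (by omega)
      exact (Nat.log_lt_of_lt_pow hpos.ne' hlt).le
  omega

/-! ### The Boolean far side gives multiplier-robust constant-free growth -/

/-- **`PerModPowBooleanHard → CF^ult`** (multiplier-robust `BooleanShadowToCF`): if for some
`c` every fixed jet had, eventually, a multiple `M·J_(n,j)` with `v₂(M) ≤ n^c` and `τ < n^c`, then
for each `k` the `k` low bits of the `0/1` permanent would have `B₂`-circuits of size
`≤ n^{11c+11}` for all large `n` — simulate `T = Σ_{j<k} (−2)^j 2^{E−e_j} u_j (M_j J_(n,j))`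
(`u_j` = inverse of the odd part of `M_j` modulo `2^{k+E}`, `E = n^c`) modulo `2^{k+E}` and read off
bits `E … E+k−1` — contradicting `PerModPowBooleanHard`. [cite: Burgisser2000TCS, §5 (A3)]
[cite: Valiant1979Permanent, §4] -/
theorem cfUltimate_of_perModPowBooleanHard (hHard : PerModPowBooleanHard) :
    ∀ c : ℕ, ∃ k : ℕ, 1 ≤ k ∧ ∀ n₀ : ℕ, ∃ n : ℕ, n₀ ≤ n ∧ ∀ M : ℕ, 1 ≤ M →
      padicValNat 2 M ≤ n ^ c → n ^ c ≤ constantFreeComplexity ((M : ℤ) • jet n k) := by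
  by_contra hCF
  push Not at hCF
  obtain ⟨c, hc⟩ := hCF
  -- `hc : ∀ k, 1 ≤ k → ∃ n₀, ∀ n, n₀ ≤ n → ∃ M, 1 ≤ M ∧ v₂ M ≤ n^c ∧ τ (M • J n k) < n ^ c`
  obtain ⟨k, hk1, hk⟩ := hHard (11 * c + 11)
  -- thresholds for the jets `1 ≤ j < k`
  have hthr : ∀ j : ℕ, ∃ n₀ : ℕ, 1 ≤ j → ∀ n, n₀ ≤ n → ∃ M : ℕ, 1 ≤ M ∧
      padicValNat 2 M ≤ n ^ c ∧ constantFreeComplexity ((M : ℤ) • jet n j) < n ^ c := by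
    intro j
    by_cases hj : 1 ≤ j
    · obtain ⟨n₀, hn₀⟩ := hc j hj
      exact ⟨n₀, fun _ => hn₀⟩
    · exact ⟨0, fun h => absurd h hj⟩
  choose N₀ hN₀ using hthr
  obtain ⟨n, hn, hnot⟩ := hk (max ((Finset.range k).sup N₀) (max 64 k))
  apply hnot
  have hnN : ∀ j, j < k → N₀ j ≤ n := fun j hj =>
    le_trans (Finset.le_sup (Finset.mem_range.mpr hj)) (le_trans (le_max_left _ _) hn)
  have hn64 : 64 ≤ n := le_trans (le_trans (le_max_left _ _) (le_max_right _ _)) hn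
  have hkn : k ≤ n := le_trans (le_trans (le_max_right _ _) (le_max_right _ _)) hn
  -- the multipliers `M_j` (with `M_0 = 1`: the `0`-th jet is the determinant)
  have hJ0 : jet n 0 = detPoly (Fin n) ℤ := by
    rw [jet, detPoly_eq_sum]
    refine Finset.sum_congr rfl fun σ _ => ?_
    simp
  have hmult : ∀ j : Fin k, ∃ M : ℕ, 1 ≤ M ∧ padicValNat 2 M ≤ n ^ c ∧
      constantFreeComplexity ((M : ℤ) • jet n j) ≤
        (if (j : ℕ) = 0 then 4 * (n + 1) ^ 4 else n ^ c) := by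
    intro j
    by_cases hj0 : (j : ℕ) = 0
    · refine ⟨1, le_rfl, by simp, ?_⟩
      rw [if_pos hj0, hj0, Nat.cast_one, one_smul, hJ0]
      exact constantFreeComplexity_detPoly_le n
    · obtain ⟨M, hM, hv, hτ⟩ := hN₀ j (by omega) n (hnN j j.isLt)
      exact ⟨M, hM, hv, by rw [if_neg hj0]; exact hτ.le⟩
  choose Mj hMj1 hMjv hMjτ using hmult
  -- `M_j = 2^{e_j} m_j`, `m_j` odd, `e_j = v₂(M_j) ≤ E := n^c`
  have hdec : ∀ j : Fin k, ∃ e m : ℕ, Odd m ∧ Mj j = 2 ^ e * m ∧ e ≤ n ^ c := by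
    intro j
    obtain ⟨e, m, hm, hMe⟩ := Nat.exists_eq_two_pow_mul_odd (show Mj j ≠ 0 by have := hMj1 j; omega)
    refine ⟨e, m, hm, hMe, ?_⟩
    have hm0 : m ≠ 0 := by rintro rfl; exact (Nat.not_odd_zero hm).elim
    have hv : padicValNat 2 (Mj j) = e := by
      rw [hMe, padicValNat.mul (pow_ne_zero _ two_ne_zero) hm0, padicValNat.prime_pow,
        padicValNat.eq_zero_of_not_dvd hm.not_two_dvd_nat, add_zero]
    exact hv ▸ hMjv j
  choose ej mj hmj hMdec hej using hdec
  -- `E = n^c`, `K = k + E` (kept opaque)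
  obtain ⟨E, hE⟩ : ∃ E : ℕ, E = n ^ c := ⟨_, rfl⟩
  obtain ⟨K, hK⟩ : ∃ K : ℕ, K = k + E := ⟨_, rfl⟩
  haveI : NeZero (2 ^ K) := ⟨pow_ne_zero _ two_ne_zero⟩
  have hejE : ∀ j, ej j ≤ E := fun j => hE ▸ hej j
  -- the inverses of the odd parts modulo `2^K` and the scalars of `T`
  obtain ⟨uj, huj⟩ : ∃ uj : Fin k → ℕ, uj = fun j : Fin k => ((((mj j : ZMod (2 ^ K))))⁻¹).val :=
    ⟨_, rfl⟩
  have huj_lt : ∀ j, uj j < 2 ^ K := fun j => by rw [huj]; exact ZMod.val_lt _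
  obtain ⟨a, ha⟩ : ∃ a : Fin k → ℤ, a = fun j : Fin k => (-2 : ℤ) ^ (j : ℕ) * 2 ^ (E - ej j) * (uj j : ℤ) :=
    ⟨_, rfl⟩
  have hmul : ∀ j : Fin k, ((a j : ℤ) : ZMod (2 ^ K)) * ((Mj j : ℕ) : ZMod (2 ^ K)) =
      (-2 : ZMod (2 ^ K)) ^ (j : ℕ) * 2 ^ E := by
    intro j
    rw [ha, hMdec j, huj]
    exact termScalar_mul_multiplier K E (ej j) (mj j) j (hmj j) (hejE j)
  obtain ⟨T, hT⟩ : ∃ T : MvPolynomial (Fin n × Fin n) ℤ,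
      T = ∑ j : Fin k, C (a j) * ((Mj j : ℤ) • jet n j) := ⟨_, rfl⟩
  -- its constant-free cost
  have hτT : constantFreeComplexity T ≤
      k * (9 * (k + n ^ c) + 2) + 4 * (n + 1) ^ 4 + k * n ^ c + k := by
    rw [hT]
    refine (constantFreeComplexity_finset_sum_le _ _).trans ?_
    rw [Finset.card_univ, Fintype.card_fin]
    have hterm : ∀ j : Fin k, constantFreeComplexity (C (a j) * ((Mj j : ℤ) • jet n j)) ≤
        (9 * K + 2) + (if (j : ℕ) = 0 then 4 * (n + 1) ^ 4 else n ^ c) := by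
      intro j
      refine (constantFreeComplexity_mul_le _ _).trans ?_
      have h1 : constantFreeComplexity (C (a j) : MvPolynomial (Fin n × Fin n) ℤ) ≤ 9 * K + 1 := by
        rw [ha]
        exact constantFreeComplexity_termScalar_le K E (ej j) j (uj j) (by omega) (by omega) (huj_lt j)
      have h2 := hMjτ j
      omega
    refine (Nat.add_le_add_right (Finset.sum_le_sum fun j _ => hterm j) k).trans ?_
    rw [Finset.sum_add_distrib, Finset.sum_const, Finset.card_univ, Fintype.card_fin, smul_eq_mul]
    have hsplit : ∑ j : Fin k, (if (j : ℕ) = 0 then 4 * (n + 1) ^ 4 else n ^ c) ≤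
        4 * (n + 1) ^ 4 + k * n ^ c := by
      rw [Finset.sum_ite, Finset.sum_const, Finset.sum_const, smul_eq_mul, smul_eq_mul]
      have h1 : (Finset.univ.filter (fun j : Fin k => (j : ℕ) = 0)).card ≤ 1 := by
        refine Finset.card_le_one_iff.mpr ?_
        intro a b ha hb
        rw [Finset.mem_filter] at ha hb
        exact Fin.ext (by rw [ha.2, hb.2])
      have h2 : (Finset.univ.filter (fun j : Fin k => ¬ (j : ℕ) = 0)).card ≤ k :=
        (Finset.card_filter_le _ _).trans (by simp)
      nlinarith [Nat.zero_le (4 * (n + 1) ^ 4), Nat.zero_le (n ^ c)]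
    have hKk : K = k + n ^ c := by rw [hK, hE]
    rw [hKk]
    omega
  -- an optimal constant-free circuit for `T`, simulated modulo `2^K`
  obtain ⟨P, hP2, hPc, hPe, hPs⟩ := exists_computes_size_eq_constantFreeComplexity T
  have hK1 : 1 ≤ K := by omega
  have hsim := cktSize_testBits_aeval_eval (p := 2 ^ K) (ℓ := K) le_rfl
    (fun (y : Fin n × Fin n → Bool) (v : Fin n × Fin n) => if y v then (1 : ZMod (2 ^ K)) else 0)
    (fun v => cktSize_inputResidue hK1 v) P hP2
  -- `T(y) ≡ 2^E per(y) (mod 2^K)` at every `0/1` point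
  obtain ⟨R, hR⟩ := twoAdicShadow_proof n k
  have hR' : perPoly (Fin n) ℤ - ∑ j ∈ Finset.range k, ((-2 : ℤ) ^ j) • jet n j = ((2 : ℤ) ^ k) • R :=
    hR
  have hS : (∑ j ∈ Finset.range k, ((-2 : ℤ) ^ j) • jet n j) =
      perPoly (Fin n) ℤ - ((2 : ℤ) ^ k) • R := by
    rw [← hR']; ring
  have hval : ∀ y : Fin n × Fin n → Bool,
      aeval (fun v => if y v then (1 : ZMod (2 ^ K)) else 0) P.eval =
        ((2 ^ E * permCount n y : ℕ) : ZMod (2 ^ K)) := by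
    intro y
    have hPe' : P.eval = T := hPe
    -- evaluate `T` termwise
    have hTy : aeval (fun v => if y v then (1 : ZMod (2 ^ K)) else 0) T = (2 : ZMod (2 ^ K)) ^ E *
        aeval (fun v => if y v then (1 : ZMod (2 ^ K)) else 0)
          (∑ j ∈ Finset.range k, ((-2 : ℤ) ^ j) • jet n j) := by
      rw [hT, map_sum, map_sum, Finset.mul_sum, Finset.sum_range]
      refine Finset.sum_congr rfl fun j _ => ?_
      rw [MvPolynomial.smul_eq_C_mul, MvPolynomial.smul_eq_C_mul,
        map_mul (aeval fun v => if y v then (1 : ZMod (2 ^ K)) else 0),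
        map_mul (aeval fun v => if y v then (1 : ZMod (2 ^ K)) else 0),
        map_mul (aeval fun v => if y v then (1 : ZMod (2 ^ K)) else 0),
        MvPolynomial.aeval_C, MvPolynomial.aeval_C, MvPolynomial.aeval_C]
      simp only [algebraMap_int_eq, eq_intCast, Int.cast_natCast, Int.cast_pow, Int.cast_neg,
        Int.cast_ofNat]
      have hm := hmul j
      rw [← mul_assoc, hm]
      ring
    rw [hPe', hTy, hS, map_sub, aeval_perPoly_bool, MvPolynomial.smul_eq_C_mul,
      map_mul (aeval fun v => if y v then (1 : ZMod (2 ^ K)) else 0), MvPolynomial.aeval_C]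
    have h2K : ((2 : ZMod (2 ^ K)) ^ E) * (2 : ZMod (2 ^ K)) ^ k = 0 := by
      rw [← pow_add, show E + k = K by omega]
      have := ZMod.natCast_self (2 ^ K)
      push_cast at this
      exact this
    simp only [algebraMap_int_eq, eq_intCast, Int.cast_pow, Int.cast_ofNat]
    rw [mul_sub, ← mul_assoc, h2K, zero_mul, sub_zero]
    push_cast
    ring
  -- read off bits `E, …, E + k - 1`
  have hshift := hsim.outMap (fun i : Fin k => (⟨E + i, by omega⟩ : Fin K))
  refine (hshift.congr fun y i => ?_).of_le ?_
  · simp only [testBits_apply]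
    rw [hval y, ZMod.val_natCast, hK, testBit_two_pow_mul_mod E k _ i i.isLt]
    rfl
  · rw [hPs]
    subst hE; subst hK
    exact le_trans (Nat.mul_le_mul_left _ (gateCost_le _ 1)) (by
      simpa [Nat.mul_one] using size_le_pow_ultimate (c := c) hn64 hkn hτT)

end Summit.ValiantsHypothesis.ValiantsHypothesis.Theorems.AnyonJets.JetConstantElim

end
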